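import Summits.CriticalPhenomena.PercolationContinuityZ3.Theorems.PercNearOneGluingNoHeavyLowerTailAntitheticLobeFlip
import Summits.CriticalPhenomena.PercolationContinuityZ3.Theorems.PercNearOneGluingNoHeavyLowerTailAntitheticFrozenPieces
import HarnessLib

/-!
# `NoHeavyLowerTail` (stmt-CriticalPhenomena-4575) — antithetic cluster pairs: the GENERAL LOBE-FAMILY THEOREM (no firmness)
# (prim-hp-2 gen 52, MEMO-gen52 §1)

Support file (`--supports stmt-CriticalPhenomena-4575`, hull-port prover `prim-hp-2`, gen 52).  No definitions, no named facts, no sorries;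
standard axioms.

Setting as in `…AntitheticLobeFlip` / `…AntitheticFirmFamily`: a colouring `x` of `E` (ANY colouring — nested or crossing), red vertex
cluster `J`, blue vertex cluster `U`, and closed sets `M i` (`i : ι`) of blue-only vertices which COVER `U ∖ J` (a grouping of ALL blue lobes
of `x`; the groups need not be single lobes and need not be disjoint); `y_T = x ∆ {e ∈ E : e meets ⋃_{i∈T} M i}` for `T ⊆ ι`.

**THEOREM (lobe-family inequality, MEMO-gen52 §1)** `Antithetic.family_sum_nonneg`: for increasing vertex functions `F, G`,
`0 ≤ Σ_{T ⊆ ι} Δ_{F,G}(y_T)`, `Δ_{F,G}(ω) = (F(W(ω)) − F(W'(ω)))·(G(W(ω)) − G(W'(ω)))`.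
This removes the firmness hypothesis of `Antithetic.firm_family_sum_nonneg` (gen 50) entirely.  Proof: by the lobe-flip lemma
(`lobeflip_red_eq`, `lobeflip_blue_subset`) `T ↦ (W(y_T), W'(y_T))` is monotone (red cluster `J ∪ M_T` grows, blue cluster shrinks), so
`a(T) = F(W(y_T)) − F(W'(y_T))` and `b(T)` likewise are monotone on the Boolean lattice `Set ι`; moreover `W'(y_{Tᶜ}) ⊆ U ∖ M_{Tᶜ} ⊆ J ∪ M_T
= W(y_T)` (cover hypothesis), whence `a(T) + a(Tᶜ) ≥ 0` and `Σ_T a(T) ≥ 0`, `Σ_T b(T) ≥ 0`; Harris' inequality for the uniform measure on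
`Set ι` (`Antithetic.harris_uniform_cov`) gives `2^{|ι|} Σ a b ≥ (Σ a)(Σ b) ≥ 0`.
Special cases: `ι = Unit`, `M () =` all blue-only vertices: the canonical sandwich pair `{z, x_↑(z)}` of MEMO-gen50 (L1); `x` a firm nested
bottom: the firm family theorem; `x` the all-blue colouring of a star: antithetic Harris.
[cite: VandenbergHaggstromKahn2005, §1 p. 6 ("Harris' inequality")]
-/

noncomputable section

namespace Summit.CriticalPhenomena.PercolationContinuityZ3.Theorems

open Literature.Probability.Percolation
open scoped Classical symmDiff

namespace Antithetic

section Family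

variable {V : Type*} {ι : Type*} [Fintype ι]

/-- **LOBE-FAMILY THEOREM** (MEMO-gen52 §1).  `x` any colouring of `E` with red cluster `J` and blue cluster `U`; `M i` closed sets of blue-only
vertices covering `U ∖ J`.  Then `0 ≤ Σ_{T ⊆ ι} Δ(x ∆ {e ∈ E : e meets ⋃_{i∈T} M i})` for increasing vertex functions `F, G` — Harris on the
Boolean lattice `Set ι` along the monotone map `T ↦ (W(y_T), W'(y_T))`, the odd means being nonnegative because `W'(y_{Tᶜ}) ⊆ W(y_T)`.
No firmness, nestedness or disjointness hypothesis. [this work] -/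
theorem family_sum_nonneg (E x : Set (Sym2 V)) (s : V) (M : ι → Set V)
    (hMU : ∀ i, M i ⊆ openCluster (xᶜ ∩ E) s) (hMJ : ∀ i, Disjoint (M i) (openCluster (x ∩ E) s))
    (hcl : ∀ i a b, s(a, b) ∈ E → a ∈ M i → b ∈ openCluster (xᶜ ∩ E) s → b ∉ openCluster (x ∩ E) s → b ∈ M i)
    (hcov : openCluster (xᶜ ∩ E) s \ openCluster (x ∩ E) s ⊆ ⋃ i, M i)
    {F G : Set V → ℝ} (hF : Monotone F) (hG : Monotone G) :
    0 ≤ ∑ T : Set ι, (F (openCluster ((x ∆ {e | e ∈ E ∧ ∃ v ∈ e, v ∈ ⋃ i ∈ T, M i}) ∩ E) s) -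
        F (openCluster ((x ∆ {e | e ∈ E ∧ ∃ v ∈ e, v ∈ ⋃ i ∈ T, M i})ᶜ ∩ E) s)) *
      (G (openCluster ((x ∆ {e | e ∈ E ∧ ∃ v ∈ e, v ∈ ⋃ i ∈ T, M i}) ∩ E) s) -
        G (openCluster ((x ∆ {e | e ∈ E ∧ ∃ v ∈ e, v ∈ ⋃ i ∈ T, M i})ᶜ ∩ E) s)) := by
  -- notation
  set J := openCluster (x ∩ E) s with hJ
  set U := openCluster (xᶜ ∩ E) s with hU
  let Fl : Set V → Set (Sym2 V) := fun S => {e | e ∈ E ∧ ∃ v ∈ e, v ∈ S}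
  let y : Set ι → Set (Sym2 V) := fun T => x ∆ Fl (⋃ i ∈ T, M i)
  let Wr : Set ι → Set V := fun T => openCluster (y T ∩ E) s
  let Wb : Set ι → Set V := fun T => openCluster ((y T)ᶜ ∩ E) s
  let a : Set ι → ℝ := fun T => F (Wr T) - F (Wb T)
  let b : Set ι → ℝ := fun T => G (Wr T) - G (Wb T)
  show 0 ≤ ∑ T : Set ι, a T * b T
  -- hypotheses of the lobe-flip lemmas for the unions ⋃_{i∈T} M i
  have hSU : ∀ T : Set ι, (⋃ i ∈ T, M i) ⊆ U := fun T =>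
    Set.iUnion₂_subset fun i _ => hMU i
  have hSJ : ∀ T : Set ι, Disjoint (⋃ i ∈ T, M i) J := fun T =>
    Set.disjoint_left.2 fun v hv hvJ => by
      obtain ⟨i, -, hvi⟩ := Set.mem_iUnion₂.1 hv
      exact Set.disjoint_left.1 (hMJ i) hvi hvJ
  have hScl : ∀ T : Set ι, ∀ a' b', s(a', b') ∈ E → a' ∈ (⋃ i ∈ T, M i) → b' ∈ U → b' ∉ J → b' ∈ (⋃ i ∈ T, M i) := by
    intro T a' b' hE ha hbU hbJ
    obtain ⟨i, hi, hai⟩ := Set.mem_iUnion₂.1 ha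
    exact Set.mem_iUnion₂.2 ⟨i, hi, hcl i a' b' hE hai hbU hbJ⟩
  -- red clusters: exactly J ∪ M_T
  have hWr : ∀ T : Set ι, Wr T = J ∪ ⋃ i ∈ T, M i := fun T =>
    lobeflip_red_eq E x s (⋃ i ∈ T, M i) (hSU T) (hSJ T) (hScl T)
  -- blue clusters: antitone, and inside U ∖ M_T
  have hWb_anti : ∀ T T' : Set ι, T ⊆ T' → Wb T' ⊆ Wb T := by
    intro T T' hTT' v hv
    have hsub : (⋃ i ∈ T, M i) ⊆ (⋃ i ∈ T', M i) := Set.biUnion_subset_biUnion_left hTT'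
    exact (lobeflip_blue_subset E x s _ _ hsub (hSJ T') (hScl T') hv).1
  have hWb_U : ∀ T : Set ι, Wb T ⊆ U \ ⋃ i ∈ T, M i := by
    intro T v hv
    have h := lobeflip_blue_subset E x s ∅ (⋃ i ∈ T, M i) (Set.empty_subset _) (hSJ T) (hScl T) hv
    have h0 : {e : Sym2 V | e ∈ E ∧ ∃ v ∈ e, v ∈ (∅ : Set V)} = ∅ := by ext e; simp
    have hx0 : x ∆ (∅ : Set (Sym2 V)) = x := by
      rw [Set.symmDiff_def, Set.sdiff_empty, Set.empty_sdiff, Set.union_empty]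
    rw [h0, hx0] at h
    exact h
  -- the cover: U ∖ M_{Tᶜ} ⊆ J ∪ M_T
  have hcross : ∀ T : Set ι, Wb Tᶜ ⊆ Wr T := by
    intro T v hv
    rw [hWr T]
    obtain ⟨hvU, hvM⟩ := hWb_U Tᶜ hv
    by_cases hvJ : v ∈ J
    · exact Or.inl hvJ
    · obtain ⟨j, hvj⟩ := Set.mem_iUnion.1 (hcov ⟨hvU, hvJ⟩)
      have hjT : j ∈ T := by
        by_contra hj
        exact hvM (Set.mem_iUnion₂.2 ⟨j, hj, hvj⟩)
      exact Or.inr (Set.mem_iUnion₂.2 ⟨j, hjT, hvj⟩)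
  -- monotonicity of a, b on the Boolean lattice Set ι
  have hWr_mono : ∀ T T' : Set ι, T ⊆ T' → Wr T ⊆ Wr T' := by
    intro T T' hTT'
    rw [hWr T, hWr T']
    exact Set.union_subset_union_right J (Set.biUnion_subset_biUnion_left hTT')
  have ha : Monotone a := fun T T' hTT' =>
    sub_le_sub (hF (hWr_mono T T' hTT')) (hF (hWb_anti T T' hTT'))
  have hb : Monotone b := fun T T' hTT' =>
    sub_le_sub (hG (hWr_mono T T' hTT')) (hG (hWb_anti T T' hTT'))
  -- nonnegative means: a T + a Tᶜ ≥ 0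
  have hpair : ∀ {H : Set V → ℝ}, Monotone H → ∀ T : Set ι,
      0 ≤ (H (Wr T) - H (Wb T)) + (H (Wr Tᶜ) - H (Wb Tᶜ)) := by
    intro H hH T
    have h1 : H (Wb Tᶜ) ≤ H (Wr T) := hH (hcross T)
    have h2 : H (Wb T) ≤ H (Wr Tᶜ) := by
      have := hcross Tᶜ
      rw [compl_compl] at this
      exact hH this
    linarith
  have hsumc : ∀ (c : Set ι → ℝ), ∑ T : Set ι, c Tᶜ = ∑ T : Set ι, c T := fun c =>
    Fintype.sum_equiv (Equiv.mk compl compl compl_compl compl_compl) _ _ fun T => rfl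
  have hmean : ∀ {H : Set V → ℝ}, Monotone H → 0 ≤ ∑ T : Set ι, (H (Wr T) - H (Wb T)) := by
    intro H hH
    have h2 : 2 * ∑ T : Set ι, (H (Wr T) - H (Wb T)) =
        ∑ T : Set ι, ((H (Wr T) - H (Wb T)) + (H (Wr Tᶜ) - H (Wb Tᶜ))) := by
      rw [Finset.sum_add_distrib, hsumc (fun T => H (Wr T) - H (Wb T))]; ring
    have h3 : 0 ≤ ∑ T : Set ι, ((H (Wr T) - H (Wb T)) + (H (Wr Tᶜ) - H (Wb Tᶜ))) :=
      Finset.sum_nonneg fun T _ => hpair hH T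
    linarith
  -- Harris on the uniform cube
  have hH := harris_uniform_cov ha hb
  have hA : 0 ≤ ∑ T, a T := hmean hF
  have hB : 0 ≤ ∑ T, b T := hmean hG
  have hN : (0 : ℝ) < (Fintype.card (Set ι) : ℝ) := by exact_mod_cast Fintype.card_pos
  have hprod : 0 ≤ (∑ T, a T) * ∑ T, b T := mul_nonneg hA hB
  nlinarith

end Family

end Antithetic

end Summit.CriticalPhenomena.PercolationContinuityZ3.Theorems
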